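import Summits.AtomisticToContinuum.HydrodynamicLimit.Theorems.AntiMazurCoboundariesCellForecastPressureDecayEntropyBallObjects
import Literature.MathematicalPhysics.KineticTheory.HardSphereEulerProofs
import Literature.MathematicalPhysics.KineticTheory.HardSphereBBGKY
import Literature.Analysis.FluidPDE.BoltzmannGradLimitProofs
import Literature.Analysis.FluidPDE.BBGKYMarginalsPartitionProofs
import HarnessLib

/-!
# Cell → torus reduction, piece (B1): the torus canonical Gibbs law is a probability measure
# (crux `CellForecastPressureDecay`, stmt-AtomisticToContinuum-13915; line `entropy-ball-invariant-states`,
# stub `stub_torusReduction`)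

All declarations live in the sub-namespace `…Theorems.EntropyBall.TorusReduction` (no clash with the frame
files of the sibling stubs of the line).

First self-contained piece of the registered stub `stub_torusReduction : TorusInfluenceLocality →
CellToTorusReduction` (objects module `…EntropyBallObjects`): the conjunct
`IsProbabilityMeasure (torusGibbs (σ / Λ) n Φ)` of `CellToTorusReduction`, for every particle number
`n ≤ 2Λ³`, every side `Λ > 0` and every `0 ≤ σ ≤ 1/4` — the regime of the stub (`n ≤ 2L³ ≤ 2Λ³`).

* `canonicalPartition_antitone_diam`: the canonical partition function of a nonnegative integrable
  datum decreases with the diameter (the hard-sphere domain shrinks);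
* `canonicalPartition_torus_maxwellian_eq_posPartition`: for the Maxwellian datum `M(v)` on `𝕋³` it is the
  configurational partition function `posPartition 1 ε n` of `HardSphereEulerProofs` (velocities integrate out);
* `canonicalPartition_torus_maxwellian_pos`: it is positive at diameter `σ/Λ` for `n ≤ 2Λ³`, `σ ≤ 1/4` — by
  monotonicity from the grid configuration of `posPartition_pos` at the larger diameter
  `hsDiameter (2σ) (n-1) = 2σ n^{-1/3} ≥ σ/Λ`;
* `isProbabilityMeasure_torusGibbs_of_le`: hence `torusGibbs (σ/Λ) n Φ` is a probability measure, whatever the flow.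
-/

noncomputable section

open MeasureTheory Set Filter
open scoped ENNReal

namespace Summit.AtomisticToContinuum.HydrodynamicLimit.Theorems.EntropyBall

open Literature.MathematicalPhysics.KineticTheory (T3 V3 hsDiameter localGibbsProfile posPartition
  posPartition_pos canonicalPartition_eq_posPartition)
open Literature.Analysis.FluidPDE

namespace TorusReduction

/-- **The canonical partition function decreases with the diameter**: for a nonnegative integrable
one-particle datum and `ε ≤ ε'`, `𝒵_N(ε') ≤ 𝒵_N(ε)` (the hard-sphere domain `D_{ε'}^N ⊆ D_ε^N`). Stated for
the torus geometry, where the domain is measurable. -/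
theorem canonicalPartition_antitone_diam {ε ε' : ℝ} (hε : ε ≤ ε') (N : ℕ) {f₀ : T3 × V3 → ℝ}
    (hf₀ : 0 ≤ f₀) (hf₀i : Integrable f₀) :
    canonicalPartition (Torus.geometry (Fin 3)) ε' N f₀ ≤ canonicalPartition (Torus.geometry (Fin 3)) ε N f₀ := by
  unfold canonicalPartition
  have hsub : hardSphereDomain (Torus.geometry (Fin 3)) N ε' ⊆ hardSphereDomain (Torus.geometry (Fin 3)) N ε :=
    fun z hz i j hij => hε.trans (hz i j hij)
  refine integral_mono_of_nonneg (Eventually.of_forall fun z =>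
      Set.indicator_nonneg (fun w _ => tensorPow_nonneg hf₀ N w) z)
    ((integrable_tensorPow N hf₀i).indicator
      (measurableSet_hardSphereDomain _ Torus.measurable_geometry_sepVec N ε))
    (Eventually.of_forall fun z => ?_)
  exact Set.indicator_le_indicator_of_subset hsub (fun w => tensorPow_nonneg hf₀ N w) z

/-- The Maxwellian datum `M(v)` on `𝕋³ × ℝ³` is the local Gibbs profile with unit activity, unit temperature
and zero drift. -/
theorem maxwellian_eq_localGibbsProfile :
    (fun p : T3 × V3 => globalMaxwellian p.2) = localGibbsProfile (fun _ => 1) (fun _ => 0) (fun _ => 1) := by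
  funext p
  simp [localGibbsProfile]

/-- **Velocities integrate out**: the torus canonical partition function of the Maxwellian datum is the
configurational partition function `posPartition 1 ε n` (Haar measure of the non-overlap set). -/
theorem canonicalPartition_torus_maxwellian_eq_posPartition (ε : ℝ) (n : ℕ) :
    canonicalPartition (Torus.geometry (Fin 3)) ε n (fun p : T3 × V3 => globalMaxwellian p.2) =
      posPartition (fun _ => 1) ε n := by
  rw [maxwellian_eq_localGibbsProfile]
  exact canonicalPartition_eq_posPartition continuous_const continuous_const continuous_const
    (fun _ => zero_le_one) (fun _ => one_pos) ε n

/-- `σ / Λ ≤ hsDiameter (2σ) N = 2σ (N+1)^{-1/3}` as soon as `N + 1 ≤ 2Λ³` (indeed `(N+1)^{1/3} ≤ 2Λ`). -/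
theorem div_le_hsDiameter {σ Λ : ℝ} (hσ : 0 ≤ σ) (hΛ : 0 < Λ) {N : ℕ} (hN : ((N + 1 : ℕ) : ℝ) ≤ 2 * Λ ^ 3) :
    σ / Λ ≤ hsDiameter (2 * σ) N := by
  unfold hsDiameter
  set m : ℝ := ((N + 1 : ℕ) : ℝ) with hm
  have hm0 : 0 < m := by rw [hm]; positivity
  have h13 : ((2 * Λ) ^ 3) ^ ((1 : ℝ) / 3) = 2 * Λ := by
    rw [show ((1 : ℝ) / 3) = ((3 : ℕ) : ℝ)⁻¹ by norm_num]
    exact Real.pow_rpow_inv_natCast (by positivity) (by norm_num)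
  have hle : m ^ ((1 : ℝ) / 3) ≤ 2 * Λ := by
    rw [← h13]
    refine Real.rpow_le_rpow hm0.le ?_ (by norm_num)
    calc m ≤ 2 * Λ ^ 3 := hN
      _ ≤ (2 * Λ) ^ 3 := by nlinarith [pow_pos hΛ 3]
  have hpos : 0 < m ^ ((1 : ℝ) / 3) := Real.rpow_pos_of_pos hm0 _
  rw [show (-(1 / 3 : ℝ)) = -((1 : ℝ) / 3) by ring, Real.rpow_neg hm0.le]
  rw [div_eq_mul_inv]
  calc σ * Λ⁻¹ = 2 * σ * (2 * Λ)⁻¹ := by field_simp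
    _ ≤ 2 * σ * (m ^ ((1 : ℝ) / 3))⁻¹ := by
        refine mul_le_mul_of_nonneg_left ?_ (by positivity)
        exact inv_anti₀ hpos hle

/-- **Positivity of the torus canonical partition function in the regime of the line**: for
`0 ≤ σ ≤ 1/4`, `Λ > 0` and `n ≤ 2Λ³`, the canonical partition function of `n` spheres of diameter `σ/Λ` on
`𝕋³` with Maxwellian velocities is positive (monotonicity in the diameter down from the grid configuration
of `posPartition_pos` at diameter `2σ n^{-1/3} ≥ σ/Λ`). -/
theorem canonicalPartition_torus_maxwellian_pos {σ Λ : ℝ} (hσ : 0 ≤ σ) (hσ4 : σ ≤ 1 / 4) (hΛ : 0 < Λ)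
    {n : ℕ} (hn : (n : ℝ) ≤ 2 * Λ ^ 3) :
    0 < canonicalPartition (Torus.geometry (Fin 3)) (σ / Λ) n (fun p : T3 × V3 => globalMaxwellian p.2) := by
  cases n with
  | zero => rw [canonicalPartition_zero_eq_one]; exact one_pos
  | succ N =>
    have hpos : 0 < canonicalPartition (Torus.geometry (Fin 3)) (hsDiameter (2 * σ) N) (N + 1)
        (fun p : T3 × V3 => globalMaxwellian p.2) := by
      rw [canonicalPartition_torus_maxwellian_eq_posPartition]
      exact posPartition_pos continuous_const (fun _ => one_pos) (by linarith) N
    refine hpos.trans_le (canonicalPartition_antitone_diam (div_le_hsDiameter hσ hΛ hn) (N + 1)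
      (fun p => (globalMaxwellian_pos p.2).le) ?_)
    have h := (integrable_const (1 : ℝ) : Integrable (fun _ : T3 => (1 : ℝ))).mul_prod
      (integrable_globalMaxwellian (E := V3))
    rw [← Measure.volume_eq_prod] at h
    simpa only [one_mul] using h

/-- **(B1) The torus canonical Gibbs law of the line is a probability measure**: for `0 ≤ σ ≤ 1/4`,
`Λ > 0`, `n ≤ 2Λ³` and every torus hard-sphere flow `Φ` of `n` spheres of diameter `σ/Λ`,
`torusGibbs (σ/Λ) n Φ` has total mass `1`. -/
theorem isProbabilityMeasure_torusGibbs_of_le {σ Λ : ℝ} (hσ : 0 ≤ σ) (hσ4 : σ ≤ 1 / 4) (hΛ : 0 < Λ)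
    {n : ℕ} (hn : (n : ℝ) ≤ 2 * Λ ^ 3) (Φ : TorusFlow (σ / Λ) n) :
    IsProbabilityMeasure (torusGibbs (σ / Λ) n Φ) := by
  have hZ := canonicalPartition_torus_maxwellian_pos hσ hσ4 hΛ hn
  refine isProbabilityMeasure_particleLaw Φ ?_ ?_
    (Literature.MathematicalPhysics.KineticTheory.integral_canonicalDensity _ _ _ _ hZ.ne')
  · intro z
    simp only [canonicalDensity, Pi.zero_apply]
    exact mul_nonneg (inv_nonneg.2 hZ.le)
      (Set.indicator_nonneg (fun w _ => tensorPow_nonneg (fun p => (globalMaxwellian_pos p.2).le) n w) z)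
  · intro z hz
    simp only [canonicalDensity]
    rw [indicator_of_notMem hz, mul_zero]

end TorusReduction

/-- **Registered helper stub `stub_trGibbs`** (piece (B1) of `stub_torusReduction`: positivity of the torus canonical partition function and `IsProbabilityMeasure (torusGibbs (σ/Λ) n Φ)` for `n ≤ 2Λ³`, `σ ≤ 1/4`): the conjunction of this file's main results, closed. -/
theorem stub_trGibbs : (∀ (σ Λ : ℝ), 0 ≤ σ → σ ≤ 1 / 4 → 0 < Λ → ∀ n : ℕ, (n : ℝ) ≤ 2 * Λ ^ 3 → 0 < Literature.Analysis.FluidPDE.canonicalPartition (Literature.Analysis.FluidPDE.Torus.geometry (Fin 3)) (σ / Λ) n (fun p : Literature.MathematicalPhysics.KineticTheory.T3 × Literature.MathematicalPhysics.KineticTheory.V3 => Literature.Analysis.FluidPDE.globalMaxwellian p.2)) ∧ (∀ (σ Λ : ℝ), 0 ≤ σ → σ ≤ 1 / 4 → 0 < Λ → ∀ n : ℕ, (n : ℝ) ≤ 2 * Λ ^ 3 → ∀ Φ : Summit.AtomisticToContinuum.HydrodynamicLimit.Theorems.EntropyBall.TorusFlow (σ / Λ) n, MeasureTheory.IsProbabilityMeasure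 (Summit.AtomisticToContinuum.HydrodynamicLimit.Theorems.EntropyBall.torusGibbs (σ / Λ) n Φ)) :=
  ⟨fun _ _ hσ hσ4 hΛ _ hn => TorusReduction.canonicalPartition_torus_maxwellian_pos hσ hσ4 hΛ hn,
    fun _ _ hσ hσ4 hΛ _ hn Φ => TorusReduction.isProbabilityMeasure_torusGibbs_of_le hσ hσ4 hΛ hn Φ⟩


end Summit.AtomisticToContinuum.HydrodynamicLimit.Theorems.EntropyBall

end
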